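import Summits.HodgeConjecture.HodgeConjecture.Theorems.Ring2AbelianAllQuaternionSegre
import Literature.AlgebraicGeometry.HodgeTheory.AbelianLowDimensionNoncommutativeFourfolds
import Literature.AlgebraicGeometry.HodgeTheory.WeilTypeAbelianVariety
import HarnessLib

/-!
# Ring 2 · AbelianAll (seat `ab-weil-2`, gen 2) — the type III(1) fourfold cell modulo TWO REFEREED NAMED FACTS
(Floccari–Fu 2026 Thm. 1.2; Moonen–Zarhin 1999 Thm. 0.1) and nothing else

HONEST FRAMING (sub-cell `pub-hodge-ring2-ab-*`, verbatim): research route, not a corollary; conditional on HC_CM plus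
one named minimal statement. (Cell `pub-hodge-ring2`, verbatim: research route conditional on HC_CM; not a corollary;
Q11.4-sentence-2 already refuted in dim ≥ 3.) THIS FILE uses neither `HC_CM` nor `B_min`. It replaces the last typed
hypothesis of the chain `Ring2AbelianAllTypeIIIFourfolds` (gen 1) → `…TypeIIIFourfoldsKernel` → `…QuaternionSegre`
(gen 2) — the endomorphism-algebra dichotomy `QuaternionFourfoldEndInput` — by the PUBLISHED theorem it transcribes,
the tree's named Literature fact `HodgeTheory.MoonenZarhin1999_simpleFourfold_noncommutative_divisorGenerated_or_quaternion`
(`Literature/AlgebraicGeometry/HodgeTheory/AbelianLowDimensionNoncommutativeFourfolds`, filed by this seat; binder `hMZ`,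
never asserted):

Moonen–Zarhin, Math. Ann. 315 (1999), Thm. 0.1 [corpus:paper:arxiv-math_9901113 p0001]: for a complex abelian variety
`X` with `dim X ≤ 4`, with the special cases (a) `X ∼ X₁ × X₂`, `X₁` a CM elliptic curve, `k ↪ End⁰(X₂)`; (b) `X` simple of
dimension 4, `End⁰(X)` a field containing an imaginary quadratic `k` acting with multiplicities `(2,2)`; (c) `X` simple
of dimension 4 with `D = End⁰(X)` a definite quaternion algebra over `ℚ`; (d) `X` simple of dimension 4 with
`End⁰(X) = ℚ` — "(4) Suppose we are not in one of the cases (a), (b), (c) or (d). Then `Hg(X) = Sp_D(V,φ)` and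
`B•(Xⁿ) = D•(Xⁿ)` for all `n`." READ FOR A SIMPLE FOURFOLD WITH NON-COMMUTATIVE ENDOMORPHISM RING: (a) is excluded by
simplicity, (b) and (d) by non-commutativity, so EITHER (c) — and then `D = (α, β)_ℚ` with `α, β < 0` (definite), whose
standard generators `i, j` (`i² = α`, `j² = β`, `ij = -ji`), multiplied by a common denominator, are anticommuting
elements `φ, ψ ∈ End X` with `φ² = -d`, `ψ² = -e`, `d, e ∈ ℤ_{≥1}` — OR (4): every power of `X` has a divisor-generated
Hodge ring (`HodgeTheory.IsDivisorGenerated`, van Geemen 2.4–2.5).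

KERNEL: `quaternionFourfoldEndInput_of_moonenZarhin` (the fact IS the typed input of `…QuaternionSegre`, minus the
unused Weil-class binder) and **`hodgePowersOfTypeIIIFourfold_of_floccariFu_of_moonenZarhin (h5) (hMZ) :
Ring2.Atlas.HodgePowersOfTypeIIIFourfold`** — the atlas cell g4.III(1) (and the inherited g5 rows) CLOSED MODULO TWO
REFEREED NAMED FACTS, with Lemma R1, the compatible polarization and the Weil structure all supplied by the kernel
(`hasDiscOneWeilStructure_of_anticomm`). `HC_CM` ABSENT; Markman 2025 not used.

## References

* [MoonenZarhin1999LowDim] B. Moonen, Yu. Zarhin, Hodge classes on abelian varieties of low dimension, Math. Ann. 315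
  (1999) 711–733 = arXiv:math/9901113, Thm. 0.1 (cases (a)–(d), parts (2) and (4)).
* [FloccariFu2026] S. Floccari, L. Fu, J. Math. Pures Appl. 210 (2026) 103876, Thm. 1.2 (tree fact `h5`).
* [vanGeemen1994HodgeAV] B. van Geemen, LNM 1594 (1994), 2.4–2.5 (`B = D`), Lemma 5.2.
* [MumfordAV1970] D. Mumford, Abelian Varieties (1970), §19 Cor. 2 of Thm. 1, §21 (quaternion algebras of type III).
-/

set_option linter.dupNamespace false

noncomputable section

open CategoryTheory
open Literature.AlgebraicTopology.SingularHomology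
open Literature.AlgebraicGeometry Literature.AlgebraicGeometry.HodgeTheory
open Literature.AlgebraicGeometry.Motives

namespace Summit.HodgeConjecture.HodgeConjecture.Ring2.AbelianAll

/-- **The published dichotomy IS the typed `End`-algebra input of `…QuaternionSegre`** (which additionally carries the
cell's unused Weil-class binder). [cite: MoonenZarhin1999LowDim, Thm. 0.1 (cases (a)–(d) and part (4))] -/
theorem quaternionFourfoldEndInput_of_moonenZarhin
    (hMZ : MoonenZarhin1999_simpleFourfold_noncommutative_divisorGenerated_or_quaternion) :
    QuaternionFourfoldEndInput :=
  fun A _φ _d _hd hA _hφ _hW hs hnc => hMZ A hA hs hnc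

/-- Hence gen 1's dichotomy and gen 2's Albert input are consequences of the published fact (chain by name).
[cite: MoonenZarhin1999LowDim, Thm. 0.1 (cases (a)–(d) and part (4))] -/
theorem quaternionFourfoldDichotomy_of_moonenZarhin
    (hMZ : MoonenZarhin1999_simpleFourfold_noncommutative_divisorGenerated_or_quaternion) :
    QuaternionFourfoldDichotomy :=
  quaternionFourfoldDichotomy_of_albertInput
    (quaternionFourfoldAlbertInput_of_endInput (quaternionFourfoldEndInput_of_moonenZarhin hMZ))

/-- **THE TYPE III(1) FOURFOLD CELL MODULO TWO REFEREED NAMED FACTS.** Floccari–Fu 2026 Thm. 1.2 (`h5`) and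
Moonen–Zarhin 1999 Thm. 0.1 (`hMZ`) give `Ring2.Atlas.HodgePowersOfTypeIIIFourfold`: the Hodge conjecture for ALL
POWERS of every simple complex abelian fourfold with non-commutative endomorphism ring and a `(2,2)` Weil structure —
in particular of every abelian fourfold of Albert type III(1), for every `(D, T)`. Everything between the two facts
(the compatible polarization by double Segre symmetrisation, the Rosati closure on `H²`, the `ℚ(θ)`-stable Lagrangian,
i.e. Lemma R1) is PROVED in the tree. `HC_CM` ABSENT; Markman 2025 and Abdulali's domination theorems not used.
[cite: FloccariFu2026, Theorem 1.2] [cite: MoonenZarhin1999LowDim, Thm. 0.1 (cases (a)–(d) and part (4))] -/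
theorem hodgePowersOfTypeIIIFourfold_of_floccariFu_of_moonenZarhin
    (h5 : FloccariFu2026_hodgeClasses_algebraic_powers_discOneWeilFourfold)
    (hMZ : MoonenZarhin1999_simpleFourfold_noncommutative_divisorGenerated_or_quaternion) :
    Ring2.Atlas.HodgePowersOfTypeIIIFourfold :=
  hodgePowersOfTypeIIIFourfold_of_floccariFu_of_endInput h5 (quaternionFourfoldEndInput_of_moonenZarhin hMZ)

/-- The same through the atlas's discriminant-1 sub-cell `Ring2.Atlas.HodgePowersOfDiscOneWeilFourfold` (whose only
supplier today is the Floccari–Fu fact): the type III(1) cell is a SUB-CELL of the discriminant-1 cell modulo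
Moonen–Zarhin's dichotomy. [cite: MoonenZarhin1999LowDim, Thm. 0.1 (cases (a)–(d) and part (4))]
[cite: FloccariFu2026, Theorem 1.2] -/
theorem hodgePowersOfTypeIIIFourfold_of_discOneWeilFourfold_of_moonenZarhin
    (h : Ring2.Atlas.HodgePowersOfDiscOneWeilFourfold)
    (hMZ : MoonenZarhin1999_simpleFourfold_noncommutative_divisorGenerated_or_quaternion) :
    Ring2.Atlas.HodgePowersOfTypeIIIFourfold :=
  hodgePowersOfTypeIIIFourfold_of_discOneWeilFourfold_of_endInput h (quaternionFourfoldEndInput_of_moonenZarhin hMZ)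

/-- Per variety, with no cell binders: **HC for all powers of every SIMPLE abelian fourfold with non-commutative
endomorphism ring**, modulo the two refereed facts (type II members by `B = D`, type III(1) members by Floccari–Fu via
the kernel's Lemma R1). [cite: FloccariFu2026, Theorem 1.2]
[cite: MoonenZarhin1999LowDim, Thm. 0.1 (cases (a)–(d) and part (4))] [cite: vanGeemen1994HodgeAV, §2.4] -/
theorem hodgeConjectureFor_powSucc_of_simple_noncomm_fourfold
    (h5 : FloccariFu2026_hodgeClasses_algebraic_powers_discOneWeilFourfold)
    (hMZ : MoonenZarhin1999_simpleFourfold_noncommutative_divisorGenerated_or_quaternion)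
    {A : AbelianVariety ℂ} (hA : A.dim = 4) (hs : A.IsSimple) (hnc : ∃ ψ χ : A ⟶ A, ψ ≫ χ ≠ χ ≫ ψ) (N : ℕ) :
    HodgeConjectureFor (A.powSucc N).dim (A.powSucc N).X := by
  rcases hMZ A hA hs hnc with hD | ⟨φ, ψ, d, e, hd, he, hφ, hψ, h⟩
  · exact hodgeConjectureFor_of_isDivisorGenerated (A.powSucc N) (hD N)
  · exact hodgeConjectureFor_powSucc_of_floccariFu_of_anticomm h5 hA hd he hφ hψ h N

/-! ## Split Weil type: the vocabulary of the Weil-type ladder -/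

/-- **Every abelian fourfold with a definite quaternion order in `End A` is of SPLIT Weil type `(2, m)` for some
`φ'` with `φ' ≫ φ' = -m`** (`IsSplitWeilType` of `HodgeTheory/WeilTypeAbelianVariety`: Weil type `(2, m)` AND a
hyperbolic `K`-symmetrised hyperplane class; Weil type itself follows from hyperbolicity, `isSplitWeilType_iff`) — so every
type III(1) fourfold lies on a SPLIT (discriminant-1) component of the fourfold Weil locus, in the ladder's own words.
[cite: vanGeemen1994HodgeAV, Lemma 5.2 (1)–(3) and 5.4 (5.4.1)] [cite: MoonenZarhin1999LowDim, Thm. 0.1 (2) (c)] -/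
theorem exists_isSplitWeilType_of_anticomm {A : AbelianVariety ℂ} (hA : A.dim = 4) {φ ψ : A ⟶ A} {d e : ℕ}
    (hd : 0 < d) (he : 0 < e) (hφ : φ ≫ φ = -(d • 𝟙 A)) (hψ : ψ ≫ ψ = -(e • 𝟙 A)) (h : φ ≫ ψ = -(ψ ≫ φ)) :
    ∃ (φ' : A ⟶ A) (m : ℕ), IsSplitWeilType A φ' 2 m := by
  obtain ⟨φ', m, ι, a, hm, hφ', ha, ha0, hyp⟩ := hasDiscOneWeilStructure_of_anticomm hA hd he hφ hψ h
  exact ⟨φ', m, isSplitWeilType_iff.2 ⟨two_pos, hm, by rw [hA], hφ', ι, a, ha, ha0, hyp⟩⟩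

/-- The same for every simple abelian fourfold with non-commutative endomorphism ring that is NOT divisor-generated
on all powers (i.e. the type III(1) members), modulo Moonen–Zarhin's dichotomy.
[cite: MoonenZarhin1999LowDim, Thm. 0.1 (cases (a)–(d) and part (4))] [cite: vanGeemen1994HodgeAV, Lemma 5.2 and 5.4] -/
theorem divisorGenerated_or_exists_isSplitWeilType_of_simple_noncomm_fourfold
    (hMZ : MoonenZarhin1999_simpleFourfold_noncommutative_divisorGenerated_or_quaternion)
    {A : AbelianVariety ℂ} (hA : A.dim = 4) (hs : A.IsSimple) (hnc : ∃ ψ χ : A ⟶ A, ψ ≫ χ ≠ χ ≫ ψ) :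
    (∀ N : ℕ, IsDivisorGenerated (A.powSucc N)) ∨ ∃ (φ' : A ⟶ A) (m : ℕ), IsSplitWeilType A φ' 2 m := by
  rcases hMZ A hA hs hnc with hD | ⟨φ, ψ, d, e, hd, he, hφ, hψ, h⟩
  · exact Or.inl hD
  · exact Or.inr (exists_isSplitWeilType_of_anticomm hA hd he hφ hψ h)

end Summit.HodgeConjecture.HodgeConjecture.Ring2.AbelianAll

end
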